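import Summits.CriticalPhenomena.PercolationContinuityZ3.Theorems.PercNearOneGluingNoHeavyLowerTailWorstPairExchange
import HarnessLib

/-!
# `NoHeavyLowerTail` (stmt-CriticalPhenomena-4575) — worst-pair exchange: the pocket-gap identity and the
# weighted-mean form

Support file (prover prim-gen-kcluster; `--supports stmt-CriticalPhenomena-4575`).  No definitions, no sorries.
Companion of `PercNearOneGluingNoHeavyLowerTailWorstPairExchange.lean` (notation `S_x, T_x, d_x` as there).
-/

noncomputable section

namespace Summit.CriticalPhenomena.PercolationContinuityZ3.Theorems

open MeasureTheory Set Literature.Probability.LatticeModels Literature.Probability.Percolation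
open scoped Classical BigOperators

/-! ## Bookkeeping identities for the worst-pair exchange

For a relay `x ∈ A` write `X := μ({o ↮ c} ∩ ⋃_{y∈A}{o ↔ y})` (the event-gluing quantity), `d_x := μ(x ↮ c)`,
`S_x := μ(o↮x, o↮c, o↔A∖{x})`, `T_x := μ(o↮x, x↮c)`.  Then EXACTLY `T_x − S_x = d_x − X`
(`pocket_gap_identity`): so `S_x ≤ T_x ⟺ X ≤ d_x`, and the worst-pair exchange `S_a S_b ≤ T_a T_b` is the
statement that `X` is at most the WEIGHTED MEAN `(T_b·d_a + S_a·d_b)/(T_b + S_a)` of the two largest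
disconnection probabilities (`worstPairExchange_iff_weightedMean`). -/

namespace WorstPairExchange

variable {n : ℕ}

/-- `μ({o↔x} ∩ {o↮c}) = μ({o↔x} ∩ {x↮c})`: on `{o ↔ x}` the events `{o ↮ c}` and `{x ↮ c}` coincide.
[folklore] -/
theorem conn_inter_compl_eq (w : Sym2 (Fin n) → unitInterval) (o c x : Fin n) :
    (prodBernoulli w).real ((openConn o x : Set (BondConfig (Fin n))) ∩ (openConn o c)ᶜ) =
      (prodBernoulli w).real ((openConn o x : Set (BondConfig (Fin n))) ∩ (openConn x c)ᶜ) := by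
  congr 1
  ext ω
  simp only [mem_inter_iff, mem_compl_iff]
  constructor
  · rintro ⟨hox, hoc⟩
    exact ⟨hox, fun hxc => hoc (SimpleGraph.Reachable.trans hox hxc)⟩
  · rintro ⟨hox, hxc⟩
    exact ⟨hox, fun hoc => hxc (SimpleGraph.Reachable.trans (SimpleGraph.Reachable.symm hox) hoc)⟩

/-- The exit event splits EXACTLY at a relay `x ∈ A`:
`X = μ({o↔x} ∩ {o↮c}) + S_x`. [folklore] -/
theorem exit_eq_conn_add_pocket (w : Sym2 (Fin n) → unitInterval) (A : Finset (Fin n)) (o c x : Fin n)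
    (hx : x ∈ A) :
    (prodBernoulli w).real ((openConn o c : Set (BondConfig (Fin n)))ᶜ ∩ ⋃ y ∈ A, openConn o y) =
      (prodBernoulli w).real ((openConn o x : Set (BondConfig (Fin n))) ∩ (openConn o c)ᶜ) +
        (prodBernoulli w).real
          ((openConn o x : Set (BondConfig (Fin n)))ᶜ ∩ (openConn o c)ᶜ ∩ ⋃ y ∈ A.erase x, openConn o y) := by
  rw [← measureReal_union (Set.disjoint_left.2 fun ω h1 h2 => h2.1.1 h1.1) MeasurableSet.of_discrete]
  congr 1
  ext ω
  simp only [mem_inter_iff, mem_compl_iff, mem_union, mem_iUnion, exists_prop, Finset.mem_erase]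
  constructor
  · rintro ⟨hoc, y, hyA, hoy⟩
    by_cases hox : ω ∈ (openConn o x : Set (BondConfig (Fin n)))
    · exact Or.inl ⟨hox, hoc⟩
    · refine Or.inr ⟨⟨hox, hoc⟩, y, ⟨?_, hyA⟩, hoy⟩
      rintro rfl
      exact hox hoy
  · rintro (⟨hox, hoc⟩ | ⟨⟨hox, hoc⟩, y, ⟨hyx, hyA⟩, hoy⟩)
    · exact ⟨hoc, x, hx, hox⟩
    · exact ⟨hoc, y, hyA, hoy⟩

/-- **Pocket gap identity**: `T_x − S_x = d_x − X` for every relay `x ∈ A`, i.e.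
`μ(o↮x, x↮c) − μ(o↮x, o↮c, o↔A∖x) = μ(x↮c) − μ({o↮c} ∩ ⋃_{y∈A}{o↔y})`.
Consequently `S_x ≤ T_x ⟺ X ≤ d_x` (event gluing at `x`). [this file] -/
theorem pocket_gap_identity (w : Sym2 (Fin n) → unitInterval) (A : Finset (Fin n)) (o c x : Fin n)
    (hx : x ∈ A) :
    (prodBernoulli w).real ((openConn o x : Set (BondConfig (Fin n)))ᶜ ∩ (openConn x c)ᶜ) -
        (prodBernoulli w).real
          ((openConn o x : Set (BondConfig (Fin n)))ᶜ ∩ (openConn o c)ᶜ ∩ ⋃ y ∈ A.erase x, openConn o y) =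
      (prodBernoulli w).real (openConn x c : Set (BondConfig (Fin n)))ᶜ -
        (prodBernoulli w).real ((openConn o c : Set (BondConfig (Fin n)))ᶜ ∩ ⋃ y ∈ A, openConn o y) := by
  have h1 := split_disconnection w o c x
  have h2 := exit_eq_conn_add_pocket w A o c x hx
  have h3 := conn_inter_compl_eq w o c x
  linarith

/-- **Worst-pair exchange ⟺ weighted-mean bound.**  For `a, b ∈ A` with `T_b + S_a > 0`:
`S_a · S_b ≤ T_a · T_b ⟺ X · (T_b + S_a) ≤ T_b · d_a + S_a · d_b`, i.e. `X ≤ (T_b d_a + S_a d_b)/(T_b + S_a)`.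
(Pure algebra from `pocket_gap_identity`: `S_a = T_a − (d_a − X)`, `S_b = T_b − (d_b − X)`.) [this file] -/
theorem worstPairExchange_iff_weightedMean (w : Sym2 (Fin n) → unitInterval) (A : Finset (Fin n))
    (o c a b : Fin n) (ha : a ∈ A) (hb : b ∈ A) :
    (prodBernoulli w).real
          ((openConn o a : Set (BondConfig (Fin n)))ᶜ ∩ (openConn o c)ᶜ ∩ ⋃ y ∈ A.erase a, openConn o y) *
        (prodBernoulli w).real
          ((openConn o b : Set (BondConfig (Fin n)))ᶜ ∩ (openConn o c)ᶜ ∩ ⋃ y ∈ A.erase b, openConn o y) ≤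
      (prodBernoulli w).real ((openConn o a : Set (BondConfig (Fin n)))ᶜ ∩ (openConn a c)ᶜ) *
        (prodBernoulli w).real ((openConn o b : Set (BondConfig (Fin n)))ᶜ ∩ (openConn b c)ᶜ) ↔
    (prodBernoulli w).real ((openConn o c : Set (BondConfig (Fin n)))ᶜ ∩ ⋃ y ∈ A, openConn o y) *
        ((prodBernoulli w).real ((openConn o b : Set (BondConfig (Fin n)))ᶜ ∩ (openConn b c)ᶜ) +
          (prodBernoulli w).real
            ((openConn o a : Set (BondConfig (Fin n)))ᶜ ∩ (openConn o c)ᶜ ∩ ⋃ y ∈ A.erase a, openConn o y)) ≤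
      (prodBernoulli w).real ((openConn o b : Set (BondConfig (Fin n)))ᶜ ∩ (openConn b c)ᶜ) *
          (prodBernoulli w).real (openConn a c : Set (BondConfig (Fin n)))ᶜ +
        (prodBernoulli w).real
            ((openConn o a : Set (BondConfig (Fin n)))ᶜ ∩ (openConn o c)ᶜ ∩ ⋃ y ∈ A.erase a, openConn o y) *
          (prodBernoulli w).real (openConn b c : Set (BondConfig (Fin n)))ᶜ := by
  set μ := prodBernoulli w with hμ
  set Sa := μ.real ((openConn o a : Set (BondConfig (Fin n)))ᶜ ∩ (openConn o c)ᶜ ∩ ⋃ y ∈ A.erase a, openConn o y)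
  set Sb := μ.real ((openConn o b : Set (BondConfig (Fin n)))ᶜ ∩ (openConn o c)ᶜ ∩ ⋃ y ∈ A.erase b, openConn o y)
  set Ta := μ.real ((openConn o a : Set (BondConfig (Fin n)))ᶜ ∩ (openConn a c)ᶜ)
  set Tb := μ.real ((openConn o b : Set (BondConfig (Fin n)))ᶜ ∩ (openConn b c)ᶜ)
  set X := μ.real ((openConn o c : Set (BondConfig (Fin n)))ᶜ ∩ ⋃ y ∈ A, openConn o y)
  set da := μ.real (openConn a c : Set (BondConfig (Fin n)))ᶜ
  set db := μ.real (openConn b c : Set (BondConfig (Fin n)))ᶜ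
  have ia : Ta - Sa = da - X := pocket_gap_identity w A o c a ha
  have ib : Tb - Sb = db - X := pocket_gap_identity w A o c b hb
  have key : Ta * Tb - Sa * Sb = Tb * da + Sa * db - X * (Tb + Sa) := by
    linear_combination Tb * ia + Sa * ib
  constructor
  · intro h; linarith
  · intro h; linarith

end WorstPairExchange


/-! ## Constants are free for `NoHeavyLowerTail`: lossy event gluing suffices

`AdditiveGluing` (stmt-4576) is the sharp constant-`1` statement, but the crux `NoHeavyLowerTail` (stmt-4575) only needs
event gluing up to an ABSOLUTE CONSTANT `C` (uniform in `|A|`): `μ({o ↮ c} ∩ ⋃_{a∈A}{o ↔ a}) ≤ C · max_a μ(a ↮ c)` gives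
near-one gluing with `δ = ε / (2(C+1))`.  (Degree-2 certificates from the two-group calculus exist for `C = 3/2` at `|A| = 3`
but not for `C = 1` — seat notes, kit j038109.) -/

/-- **Lossy event gluing (any constant `C ≥ 0`, uniform in `|A|`) ⇒ `NearOneGluing`.** [this file] -/
theorem nearOneGluing_of_eventGluingConst (C : ℝ) (hC : 0 ≤ C)
    (hEG : ∀ (n : ℕ) (w : Sym2 (Fin n) → unitInterval) (A : Finset (Fin n)) (o c : Fin n) (s : ℝ), 0 ≤ s →
      (∀ a ∈ A, (prodBernoulli w).real (openConn a c : Set (BondConfig (Fin n)))ᶜ ≤ s) →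
      (prodBernoulli w).real ((openConn o c : Set (BondConfig (Fin n)))ᶜ ∩ ⋃ a ∈ A, openConn o a) ≤ C * s) :
    Summit.CriticalPhenomena.PercolationContinuityZ3.Theses.PercNearOneGluing.NearOneGluing := by
  intro ε hε
  refine ⟨ε / (2 * (C + 1)), by positivity, ?_⟩
  intro n w A o b hoA hAb
  set μ := prodBernoulli w with hμ
  haveI : IsProbabilityMeasure μ := by rw [hμ]; infer_instance
  set δ := ε / (2 * (C + 1)) with hδ
  have hδpos : 0 < δ := by positivity
  have hcut : ∀ a ∈ A, μ.real (openConn a b : Set (BondConfig (Fin n)))ᶜ ≤ δ := by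
    intro a ha
    have h1 := hAb a ha
    have h2 : μ.real (openConn a b : Set (BondConfig (Fin n)))ᶜ =
        1 - μ.real (openConn a b : Set (BondConfig (Fin n))) :=
      probReal_compl_eq_one_sub MeasurableSet.of_discrete
    linarith
  have hX := hEG n w A o b δ hδpos.le hcut
  have hsplit : μ.real (⋃ a ∈ A, (openConn o a : Set (BondConfig (Fin n)))) ≤
      μ.real (openConn o b : Set (BondConfig (Fin n))) +
        μ.real ((openConn o b : Set (BondConfig (Fin n)))ᶜ ∩ ⋃ a ∈ A, openConn o a) := by
    calc μ.real (⋃ a ∈ A, (openConn o a : Set (BondConfig (Fin n))))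
        ≤ μ.real ((openConn o b : Set (BondConfig (Fin n))) ∪
            ((openConn o b : Set (BondConfig (Fin n)))ᶜ ∩ ⋃ a ∈ A, openConn o a)) := by
          refine measureReal_mono fun ω hω => ?_
          by_cases hob : ω ∈ (openConn o b : Set (BondConfig (Fin n)))
          · exact Or.inl hob
          · exact Or.inr ⟨hob, hω⟩
      _ ≤ _ := measureReal_union_le _ _
  have h2 : 2 * (C + 1) * δ = ε := by
    rw [hδ]; field_simp
  have hCd : C * δ + δ = ε / 2 := by linear_combination h2 / 2
  have : 1 - ε / 2 < μ.real (openConn o b : Set (BondConfig (Fin n))) := by nlinarith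
  linarith

/-- **Lossy event gluing ⇒ `NoHeavyLowerTail`** (stmt-CriticalPhenomena-4575): constants do not matter for this crux.
[this file] -/
theorem noHeavyLowerTail_of_eventGluingConst (C : ℝ) (hC : 0 ≤ C)
    (hEG : ∀ (n : ℕ) (w : Sym2 (Fin n) → unitInterval) (A : Finset (Fin n)) (o c : Fin n) (s : ℝ), 0 ≤ s →
      (∀ a ∈ A, (prodBernoulli w).real (openConn a c : Set (BondConfig (Fin n)))ᶜ ≤ s) →
      (prodBernoulli w).real ((openConn o c : Set (BondConfig (Fin n)))ᶜ ∩ ⋃ a ∈ A, openConn o a) ≤ C * s) :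
    Summit.CriticalPhenomena.PercolationContinuityZ3.Theses.PercNearOneGluing.NoHeavyLowerTail :=
  noHeavyLowerTail_of_manyFingersLargePocket
    (manyFingersLargePocket_of_nearOneGluing (nearOneGluing_of_eventGluingConst C hC hEG))

/-- **Lossy worst-pair exchange ⇒ lossy event gluing.**  If for the two worst relays `S_a S_b ≤ C · T_a T_b` (`C ≥ 1`), then
`X ≤ √C · max d` — indeed one of `S_x ≤ √C T_x` holds, and `S_x ≤ √C T_x` gives `X = d_x − T_x + S_x ≤ d_x + (√C − 1) T_x ≤ √C d_x`.
Stated with `C' = √C` to avoid square roots: hypothesis `S_a S_b ≤ C'^2 T_a T_b`. [this file] -/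
theorem eventGluingConst_of_worstPairExchangeConst (C' : ℝ) (hC' : 1 ≤ C')
    (hWPE : ∀ (n : ℕ) (w : Sym2 (Fin n) → unitInterval) (A : Finset (Fin n)) (o c a b : Fin n),
      a ∈ A → b ∈ A → a ≠ b →
      (∀ x ∈ A, x ≠ a → x ≠ b →
        (prodBernoulli w).real (openConn x c : Set (BondConfig (Fin n)))ᶜ ≤
            (prodBernoulli w).real (openConn a c : Set (BondConfig (Fin n)))ᶜ ∧
          (prodBernoulli w).real (openConn x c : Set (BondConfig (Fin n)))ᶜ ≤
            (prodBernoulli w).real (openConn b c : Set (BondConfig (Fin n)))ᶜ) →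
      (prodBernoulli w).real
          ((openConn o a : Set (BondConfig (Fin n)))ᶜ ∩ (openConn o c)ᶜ ∩ ⋃ y ∈ A.erase a, openConn o y) *
        (prodBernoulli w).real
          ((openConn o b : Set (BondConfig (Fin n)))ᶜ ∩ (openConn o c)ᶜ ∩ ⋃ y ∈ A.erase b, openConn o y) ≤
      C' ^ 2 * ((prodBernoulli w).real ((openConn o a : Set (BondConfig (Fin n)))ᶜ ∩ (openConn a c)ᶜ) *
        (prodBernoulli w).real ((openConn o b : Set (BondConfig (Fin n)))ᶜ ∩ (openConn b c)ᶜ))) :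
    ∀ (n : ℕ) (w : Sym2 (Fin n) → unitInterval) (A : Finset (Fin n)) (o c : Fin n) (s : ℝ), 0 ≤ s →
      (∀ a ∈ A, (prodBernoulli w).real (openConn a c : Set (BondConfig (Fin n)))ᶜ ≤ s) →
      (prodBernoulli w).real ((openConn o c : Set (BondConfig (Fin n)))ᶜ ∩ ⋃ a ∈ A, openConn o a) ≤ C' * s := by
  intro n w A o c s hs hcut
  set μ := prodBernoulli w with hμ
  set d : Fin n → ℝ := fun x => μ.real (openConn x c : Set (BondConfig (Fin n)))ᶜ with hd
  -- the lossy conclusion at a relay `x` with `S_x ≤ C' T_x`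
  have conclude : ∀ x ∈ A,
      μ.real ((openConn o x : Set (BondConfig (Fin n)))ᶜ ∩ (openConn o c)ᶜ ∩ ⋃ y ∈ A.erase x, openConn o y) ≤
        C' * μ.real ((openConn o x : Set (BondConfig (Fin n)))ᶜ ∩ (openConn x c)ᶜ) →
      μ.real ((openConn o c : Set (BondConfig (Fin n)))ᶜ ∩ ⋃ a ∈ A, openConn o a) ≤ C' * s := by
    intro x hx hSx
    have gap := WorstPairExchange.pocket_gap_identity w A o c x hx
    have hsplit := WorstPairExchange.split_disconnection w o c x
    have hT0 : 0 ≤ μ.real ((openConn o x : Set (BondConfig (Fin n)))ᶜ ∩ (openConn x c)ᶜ) := measureReal_nonneg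
    have hT1 : μ.real ((openConn o x : Set (BondConfig (Fin n)))ᶜ ∩ (openConn x c)ᶜ) ≤ d x := by
      have h0 : 0 ≤ μ.real ((openConn o x : Set (BondConfig (Fin n))) ∩ (openConn x c)ᶜ) := measureReal_nonneg
      rw [hd]; dsimp only; linarith
    have hdx : d x ≤ s := hcut x hx
    -- X = d_x - T_x + S_x ≤ d_x + (C' - 1) T_x ≤ C' d_x ≤ C' s
    have hX : μ.real ((openConn o c : Set (BondConfig (Fin n)))ᶜ ∩ ⋃ a ∈ A, openConn o a) ≤
        d x + (C' - 1) * μ.real ((openConn o x : Set (BondConfig (Fin n)))ᶜ ∩ (openConn x c)ᶜ) := by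
      rw [hd]; dsimp only; linarith
    nlinarith
  rcases A.eq_empty_or_nonempty with hAe | hAne
  · subst hAe
    simp only [Finset.notMem_empty, Set.iUnion_of_empty, Set.iUnion_empty, Set.inter_empty, measureReal_empty]
    positivity
  obtain ⟨a, haA, hamax⟩ := Finset.exists_max_image A d hAne
  rcases (A.erase a).eq_empty_or_nonempty with hA1 | hA2
  · refine conclude a haA ?_
    rw [hA1]
    simp only [Finset.notMem_empty, Set.iUnion_of_empty, Set.iUnion_empty, Set.inter_empty, measureReal_empty]
    exact mul_nonneg (by linarith) measureReal_nonneg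
  obtain ⟨b, hbA', hbmax⟩ := Finset.exists_max_image (A.erase a) d hA2
  have hbA : b ∈ A := Finset.mem_of_mem_erase hbA'
  have hab : a ≠ b := fun h => (Finset.mem_erase.1 hbA').1 h.symm
  have hothers : ∀ x ∈ A, x ≠ a → x ≠ b → d x ≤ d a ∧ d x ≤ d b := fun x hx hxa _ =>
    ⟨hamax x hx, hbmax x (Finset.mem_erase.2 ⟨hxa, hx⟩)⟩
  have hprod := hWPE n w A o c a b haA hbA hab hothers
  have hTa : 0 ≤ μ.real ((openConn o a : Set (BondConfig (Fin n)))ᶜ ∩ (openConn a c)ᶜ) := measureReal_nonneg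
  have hTb : 0 ≤ μ.real ((openConn o b : Set (BondConfig (Fin n)))ᶜ ∩ (openConn b c)ᶜ) := measureReal_nonneg
  have hprod' : μ.real ((openConn o a : Set (BondConfig (Fin n)))ᶜ ∩ (openConn o c)ᶜ ∩ ⋃ y ∈ A.erase a, openConn o y) *
      μ.real ((openConn o b : Set (BondConfig (Fin n)))ᶜ ∩ (openConn o c)ᶜ ∩ ⋃ y ∈ A.erase b, openConn o y) ≤
      (C' * μ.real ((openConn o a : Set (BondConfig (Fin n)))ᶜ ∩ (openConn a c)ᶜ)) *
        (C' * μ.real ((openConn o b : Set (BondConfig (Fin n)))ᶜ ∩ (openConn b c)ᶜ)) := by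
    nlinarith
  rcases WorstPairExchange.le_or_le_of_mul_le_mul (mul_nonneg (by linarith) hTa) (mul_nonneg (by linarith) hTb) hprod'
    with h | h
  · exact conclude a haA h
  · exact conclude b hbA h

end Summit.CriticalPhenomena.PercolationContinuityZ3.Theorems

end
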